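import Literature.Topology.FourManifolds.PropertyRTraceBridgeReduction
import Literature.Topology.FourManifolds.SmoothEmbeddingCriteria
import HarnessLib

/-!
# The trace bridge T from Property R and the Morse-to-trace bridge alone

Topic `Literature/Topology/FourManifolds` (support file for the named fact (T)
`Literature.Topology.FourManifolds.exists_framedKnot_of_hasHandleDecomposition_oneZeroOne`,
`PropertyRTraceClosing.lean`).  Everything here is **proved**; no definition and no named fact is
introduced.

`PropertyRTraceBridgeReduction.lean` reduces T to (P1') "a `(1,0,1)`-handlebody is the trace of
its own Milnor framed knot" and (P4) "some trace of the `0`-framed unknot closes up to the round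
`S⁴` with a `(1,1)`-handlebody complement".  This file removes (P4) **at the price of Gabai's
Property R** (the named fact `isUnknot_of_isIntegralSurgery_zero`, `SurgeryGluck.lean`; Gabai,
J. Differential Geom. 26 (1987), Cor. 8.3) — which every consumer of T in the tree assumes anyway
(the SPC4 crux `AcyclicBisectionRigidity` consumes `R ∧ L ∧ T`): the model is the lower half
`P₀ = {f ≤ c}` of the tree's splitting of the round sphere `S⁴ = P₀ ∪ V₀`
(`exists_regularSublevel_sphereFour_oneZeroOne_oneOne`, `SphereFourOneZeroOneSplitting.lean`); by
(P1') it is the trace of its Milnor framed knot `(K₀, n₀)`, whose surgery is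
`∂P₀ ≅ ∂V₀ ≅ S² × S¹` (`nonempty_diffeomorph_boundary_sphereTwo_prod_of_handleCount_one_one_holds`),
so `n₀ = 0` (`eq_zero_of_isIntegralSurgery_boundary_regularSublevel`) and, transporting the
surgery presentation to Mathlib's product `S² × S¹`
(`isIntegralSurgery_sphereTwo_prod_sphereOne_of_diffeomorph`, across the two models `𝓡 3` and
`(𝓡 2).prod (𝓡 1)`), `K₀` is the unknot by Property R.  Hence for every `(1,0,1)`-handlebody `P`
whose Milnor knot is unknotted with framing `0`, `P ≅ P₀` by the uniqueness of the trace
(`FramedLink.IsTrace.nonempty_diffeomorph_of_isIsotopic`, `KnotTraceUniqueness.lean`), and the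
splitting of `S⁴` transports to `P`:

* `exists_framedKnot_of_hasHandleDecomposition_oneZeroOne_of_passageTrace_of_propertyR` —
  **T from (P1') and Property R.**  With it the crux's `R ∧ L ∧ T` follows from `R`, `L` and (P1')
  alone.

§1 transports open gluings and surgery presentations along diffeomorphisms between manifolds
with models on different (isomorphic) vector spaces (file-private copies of
`isSmoothEmbedding_diffeomorph_comp_of_isOpen_range`, `isOpenGluing_of_diffeomorph_of_boundaryless`,
`isIntegralSurgery_sphereTwo_prod_sphereOne_of_diffeomorph`; Kosinski 1993, VI §1), adapted from the
SPC4 skeleton stub `ConvexBisectionAcyclicBisectionRigidityStubPropertyRGluing.lean` where they were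
first proved (kept private here to avoid duplicating those public declarations).

## References

* D. Gabai, *Foliations and the topology of 3-manifolds. III*, J. Differential Geom. 26 (1987),
  Cor. 8.3. [GabaiJDG1987]
* R. C. Kirby, *The Topology of 4-Manifolds*, LNM 1374 (1989), Ch. I §2, p. 8. [Kirby1989]
* A. A. Kosinski, *Differential Manifolds* (1993), VI §1 (proof of (1.1)), VI (6.6), VII (2.2).
  [Kosinski1993]
* R. E. Gompf, M. Scharlemann, A. Thompson, Geom. Topol. 14 (2010), Prop. 2.2, Thm. 1.1 and proof
  of Prop. 9.2. [GompfScharlemannThompson2010]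
-/

noncomputable section

open Set Function
open scoped Manifold ContDiff Topology

namespace Literature.Topology.FourManifolds

/-! ### §1 Transport of open gluings and surgery presentations across models -/

section Transport

-- adapted from `Summits/SmoothPoincare4/.../ConvexBisectionAcyclicBisectionRigidityStubPropertyRGluing.lean`
variable {EA HA EB HB EP HP EP' HP' : Type*}
  [NormedAddCommGroup EA] [NormedSpace ℝ EA] [TopologicalSpace HA] {IA : ModelWithCorners ℝ EA HA}
  [NormedAddCommGroup EB] [NormedSpace ℝ EB] [TopologicalSpace HB] {IB : ModelWithCorners ℝ EB HB}
  [NormedAddCommGroup EP] [NormedSpace ℝ EP] [TopologicalSpace HP] {IP : ModelWithCorners ℝ EP HP}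
  [NormedAddCommGroup EP'] [NormedSpace ℝ EP'] [TopologicalSpace HP']
  {IP' : ModelWithCorners ℝ EP' HP'}
  {A B P P' : Type*} [TopologicalSpace A] [ChartedSpace HA A] [TopologicalSpace B]
  [ChartedSpace HB B] [TopologicalSpace P] [ChartedSpace HP P] [TopologicalSpace P']
  [ChartedSpace HP' P']

/-- **An open smooth embedding followed by a diffeomorphism is an open smooth embedding**, for
boundaryless source and (new) target whose model vector spaces are identified by `L : EA ≃L EP'`
(the models of `P` and `P'` may live on different vector spaces): `e ∘ j` is a globally defined
partial diffeomorphism onto its open range whose inverse `j⁻¹ ∘ e⁻¹` is smooth on the range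
(`contMDiffOn_symm_of_isSmoothEmbedding`), hence a smooth embedding
(`isSmoothEmbedding_of_openPartialHomeomorph`; Lee 2013, Prop. 5.2). [cite: LeeSmoothManifolds2013, Prop. 5.2] -/
private theorem isSmoothEmbedding_diffeomorph_comp_of_isOpen_range [IA.Boundaryless] [IP'.Boundaryless]
    [IsManifold IA ∞ A] [IsManifold IP' ∞ P'] {j : A → P}
    (hj : Manifold.IsSmoothEmbedding IA IP ∞ j) (ho : IsOpen (range j)) (e : P ≃ₘ⟮IP, IP'⟯ P')
    (L : EA ≃L[ℝ] EP') :
    Manifold.IsSmoothEmbedding IA IP' ∞ (e ∘ j) ∧ IsOpen (range (e ∘ j)) := by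
  have hoj : Topology.IsOpenEmbedding j := ⟨hj.isEmbedding, ho⟩
  have hoe : Topology.IsOpenEmbedding (e ∘ j) := e.toHomeomorph.isOpenEmbedding.comp hoj
  refine ⟨?_, hoe.isOpen_range⟩
  rcases isEmpty_or_nonempty A with hA | hA
  · exact ⟨Manifold.IsImmersionOfComplement.isImmersion (F := Unit) fun x ↦ isEmptyElim x,
      hoe.isEmbedding⟩
  set Φ := hoe.toOpenPartialHomeomorph (e ∘ j) with hΦdef
  have hΦ : ContMDiffOn IA IP' ∞ Φ Φ.source := (e.contMDiff.comp hj.contMDiff).contMDiffOn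
  -- the inverse `j⁻¹ ∘ e⁻¹` is smooth on the range
  have h1 : ContMDiffOn IP IA ∞ (hoj.toOpenPartialHomeomorph j).symm (range j) :=
    contMDiffOn_symm_of_isSmoothEmbedding hj hoj
  have h2 : ContMDiffOn IP' IA ∞ ((hoj.toOpenPartialHomeomorph j).symm ∘ e.symm)
      (range (e ∘ j)) :=
    h1.comp e.symm.contMDiff.contMDiffOn fun y hy => by
      obtain ⟨a, rfl⟩ := hy
      exact ⟨a, by simp⟩
  have hΦ' : ContMDiffOn IP' IA ∞ Φ.symm Φ.target := by
    rw [hΦdef, Topology.IsOpenEmbedding.toOpenPartialHomeomorph_target]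
    refine h2.congr fun y hy => ?_
    obtain ⟨a, rfl⟩ := hy
    rw [Topology.IsOpenEmbedding.toOpenPartialHomeomorph_left_inv, comp_apply, comp_apply,
      Diffeomorph.symm_apply_apply, Topology.IsOpenEmbedding.toOpenPartialHomeomorph_left_inv]
  exact isSmoothEmbedding_of_openPartialHomeomorph Φ hoe.toOpenPartialHomeomorph_source hΦ hΦ' L

/-- **Open gluings are transported along diffeomorphisms onto boundaryless manifolds with any
model on an isomorphic vector space** (compose the two gluing embeddings with `e`; Kosinski 1993,
VI §1, proof of Thm. (1.1)).  The tree's `IsOpenGluing.of_diffeomorph_of_range_eq` keeps one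
vector space for both models of `P`, `P'`; here the pieces are boundaryless and the models of
`P'` and of the pieces are compared through `LA : EA ≃L EP'`, `LB : EB ≃L EP'`.
[cite: Kosinski1993, VI §1, Thm. (1.1)] -/
private theorem isOpenGluing_of_diffeomorph_of_boundaryless [IA.Boundaryless] [IB.Boundaryless]
    [IP'.Boundaryless] [IsManifold IA ∞ A] [IsManifold IB ∞ B] [IsManifold IP' ∞ P']
    {R : A → B → Prop} (h : IsOpenGluing IA IB IP (P := P) R) (e : P ≃ₘ⟮IP, IP'⟯ P')
    (LA : EA ≃L[ℝ] EP') (LB : EB ≃L[ℝ] EP') : IsOpenGluing IA IB IP' (P := P') R := by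
  obtain ⟨jA, jB, hA, hAo, hB, hBo, hU, hR⟩ := h
  obtain ⟨hA', hAo'⟩ := isSmoothEmbedding_diffeomorph_comp_of_isOpen_range hA hAo e LA
  obtain ⟨hB', hBo'⟩ := isSmoothEmbedding_diffeomorph_comp_of_isOpen_range hB hBo e LB
  refine ⟨e ∘ jA, e ∘ jB, hA', hAo', hB', hBo', ?_, fun a b => ?_⟩
  · rw [range_comp, range_comp, ← image_union, hU, image_univ]
    exact e.surjective.range_eq
  · rw [comp_apply, comp_apply, ← hR a b]
    exact ⟨fun h => e.injective h, fun h => congrArg e h⟩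

end Transport

/-- **Surgery presentations modelled on `𝓡 3` are transported to Mathlib's product manifold
`S² × S¹`** (model `(𝓡 2).prod (𝓡 1)`): if `Y` (modelled on `ℝ³`) is `m`-surgery on `K` and
`Y ≅ S² × S¹`, then `S² × S¹` is `m`-surgery on `K` — the tubular neighbourhood and its framing are
kept, the open gluing is transported by `isOpenGluing_of_diffeomorph_of_boundaryless` (the knot
complement is modelled on `ℝ³`, the open solid torus on `ℝ² × ℝ¹`; `ℝ³ ≅ ℝ² × ℝ¹` as both have
dimension `3`).  Rolfsen 1976, §9.F (surgery is defined up to diffeomorphism). [cite: Rolfsen1976, §9.F] -/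
private theorem isIntegralSurgery_sphereTwo_prod_sphereOne_of_diffeomorph {Y : Type*} [TopologicalSpace Y]
    [ChartedSpace (EuclideanSpace ℝ (Fin 3)) Y] {K : Knot} {m : ℤ}
    (h : IsIntegralSurgery (𝓡 3) Y K m)
    (e : Y ≃ₘ⟮𝓡 3, (𝓡 2).prod (𝓡 1)⟯
      (Metric.sphere (0 : EuclideanSpace ℝ (Fin 3)) 1 × Metric.sphere (0 : EuclideanSpace ℝ (Fin 2)) 1)) :
    IsIntegralSurgery ((𝓡 2).prod (𝓡 1))
      (Metric.sphere (0 : EuclideanSpace ℝ (Fin 3)) 1 × Metric.sphere (0 : EuclideanSpace ℝ (Fin 2)) 1)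
      K m := by
  obtain ⟨ν, hν, hG⟩ := h
  have LA : EuclideanSpace ℝ (Fin 3) ≃L[ℝ] (EuclideanSpace ℝ (Fin 2) × EuclideanSpace ℝ (Fin 1)) :=
    ContinuousLinearEquiv.ofFinrankEq (by simp)
  exact ⟨ν, hν,
    isOpenGluing_of_diffeomorph_of_boundaryless hG e LA (ContinuousLinearEquiv.refl ℝ _)⟩

/-! ### §2 T from (P1') and Property R -/

/-- **The trace bridge T from the Morse-to-trace bridge (P1') and Gabai's Property R.**  Let
(P1') hold: every compact `(1,0,1)`-handlebody `P`, presented by the passage data of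
`exists_passageData_isIntegralSurgery_of_hasHandleDecomposition_oneZeroOne` (Morse function `g`,
gradient-like field `ξ`, passage setting `Ps` about the critical point of index `2`, level
`V ≅ S³`, oriented tube `ν` of the transported left-hand circle `K`, framing integer `n`), is the
trace of `(K, n)` (`(FramedLink.single K n).IsTrace P`; Kosinski 1993, VII (2.2) with Milnor 1965,
Def. 3.9 / Thm. 3.13), and let Property R hold (`isUnknot_of_isIntegralSurgery_zero`: if `S² × S¹`
is `0`-surgery on `K` then `K` is the unknot; Gabai 1987, Cor. 8.3).  Then T
(`exists_framedKnot_of_hasHandleDecomposition_oneZeroOne`) holds: the model is the lower half `P₀`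
of the tree's splitting `S⁴ = P₀ ∪ V₀`, a trace of its Milnor framed knot `(K₀, n₀)` with
`S³_{n₀}(K₀) = ∂P₀ ≅ ∂V₀ ≅ S² × S¹`, whence `n₀ = 0` and, by Property R, `K₀` is the unknot; any
`P` whose Milnor knot is unknotted with framing `0` is then diffeomorphic to `P₀` (uniqueness of the
trace) and inherits its closing (Kirby 1989, Ch. I §2, p. 8: `S⁴ = S² × B² ∪ S¹ × B³`).
[cite: Kosinski1993, VII (2.2) and VI (6.6)] [cite: GabaiJDG1987, Cor. 8.3]
[cite: Kirby1989, Ch. I §2, p. 8] -/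
theorem exists_framedKnot_of_hasHandleDecomposition_oneZeroOne_of_passageTrace_of_propertyR
    (hP1' : ∀ (P : Type) [TopologicalSpace P] [T2Space P] [SecondCountableTopology P]
      [ChartedSpace (EuclideanHalfSpace 4) P] [IsManifold (𝓡∂ 4) ∞ P] [CompactSpace P]
      (g : P → ℝ) (_ : (Cobordism.ofBoundary 3 P).IsMorseFunction g) (p q : P)
      (_ : criticalSet (𝓡∂ (3 + 1)) g = {p, q}) (_ : morseIndex (𝓡∂ (3 + 1)) g p = 0)
      (_ : morseIndex (𝓡∂ (3 + 1)) g q = 2)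
      (ξ : Cₛ^∞⟮𝓡∂ (3 + 1); EuclideanSpace ℝ (Fin (3 + 1)),
        (TangentSpace (𝓡∂ (3 + 1)) : P → Type)⟯)
      (_ : IsGradientLike (𝓡∂ (3 + 1)) g ξ)
      (Ps : Cobordism.PassageSetting (Cobordism.ofBoundary 3 P) g ⇑ξ 1) (_ : Ps.q = q)
      (V : Type) [TopologicalSpace V] [T2Space V] [ChartedSpace (EuclideanSpace ℝ (Fin 3)) V]
      [IsManifold (𝓡 3) ∞ V] [Nonempty V] (ι : V → P)
      (hι : Manifold.IsSmoothEmbedding (𝓡 3) (𝓡∂ (3 + 1)) ∞ ι) (hιr : range ι = g ⁻¹' {Ps.b})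
      (Φ : V ≃ₘ⟮𝓡 3, 𝓡 3⟯ (Metric.sphere (0 : EuclideanSpace ℝ (Fin 4)) 1))
      (ν : Knot.TubularNbhd
        ⇑(LickorishTwist.knotOfTube ((Ps.isSmoothEmbedding_tubePH ι hι hιr).diffeomorph_comp Φ)))
      (n : ℤ),
      (⇑ν = ⇑Φ ∘ ⇑(Ps.tubePH ι hι hιr) ∨ ⇑ν = fibreReflect (⇑Φ ∘ ⇑(Ps.tubePH ι hι hιr))) →
      ν.HasFraming n →
      (FramedLink.single
        (LickorishTwist.knotOfTube ((Ps.isSmoothEmbedding_tubePH ι hι hιr).diffeomorph_comp Φ))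
        n).IsTrace P)
    (hPR : isUnknot_of_isIntegralSurgery_zero) :
    exists_framedKnot_of_hasHandleDecomposition_oneZeroOne := by
  ------------------------------------------------------------------------------------------
  -- the model: the lower half of the splitting `S⁴ = P₀ ∪ V₀`
  ------------------------------------------------------------------------------------------
  obtain ⟨f, c, hf, h, -, -, -, -, h3, h4, hbelow, habove, hP₀, hV₀, -, hcV₀, -, hoV₀, hglue⟩ :=
    exists_regularSublevel_sphereFour_oneZeroOne_oneOne
  haveI : ConnectedSpace (RegularSuperlevel h) := hcV₀
  set bP₀ := RegularSublevel.boundaryData h with hbP₀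
  set bV₀ := RegularSublevel.boundaryData h.const_sub with hbV₀
  -- its Milnor framed knot `(K₀, n₀)` and the surgery presentation of `∂P₀`
  obtain ⟨g₀, hg₀, p₀, q₀, hcrit₀, hp₀, hq₀, ξ₀, hξ₀, Ps₀, hPq₀, V', _, _, _, _, _, ι₀, hι₀, hι₀r, Φ₀,
    ν₀, n₀, hν₀, hn₀, hsurg₀⟩ :=
    exists_passageData_isIntegralSurgery_of_hasHandleDecomposition_oneZeroOne (RegularSublevel h)
      hP₀ bP₀
  -- (P1'): `P₀` is the trace of `(K₀, n₀)`
  have hT₀ := hP1' (RegularSublevel h) g₀ hg₀ p₀ q₀ hcrit₀ hp₀ hq₀ ξ₀ hξ₀ Ps₀ hPq₀ V' ι₀ hι₀ hι₀r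
    Φ₀ ν₀ n₀ hν₀ hn₀
  -- `∂P₀ ≅ S² × S¹`, so `n₀ = 0` …
  have hn₀0 : n₀ = 0 :=
    eq_zero_of_isIntegralSurgery_boundary_regularSublevel hf h h3 h4 hbelow habove hsurg₀
  subst hn₀0
  -- … and `K₀` is the unknot, by Property R on the transported presentation
  obtain ⟨e₀⟩ := nonempty_diffeomorph_boundary_sphereTwo_prod_of_handleCount_one_one_holds
    (RegularSuperlevel h) hV₀ hoV₀ bV₀
  have hU₀ : (LickorishTwist.knotOfTube
      ((Ps₀.isSmoothEmbedding_tubePH ι₀ hι₀ hι₀r).diffeomorph_comp Φ₀)).IsUnknot :=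
    hPR _ (isIntegralSurgery_sphereTwo_prod_sphereOne_of_diffeomorph hsurg₀
      ((RegularSublevel.splitDiffeomorph h).trans e₀))
  ------------------------------------------------------------------------------------------
  -- T for every `P`, through the closing clause for its Milnor knot
  ------------------------------------------------------------------------------------------
  refine exists_framedKnot_of_hasHandleDecomposition_oneZeroOne_of_closing
    fun P _ _ _ _ _ _ bP g hg p q hcrit hp hq ξ hξ Ps hPq V _ _ _ _ _ ι hι hιr Φ ν n hν hn hK hn0 => ?_
  have hT := hP1' P g hg p q hcrit hp hq ξ hξ Ps hPq V ι hι hιr Φ ν n hν hn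
  subst hn0
  -- both knots are unknotted, hence isotopic; the traces are diffeomorphic
  have hiso : (LickorishTwist.knotOfTube ((Ps.isSmoothEmbedding_tubePH ι hι hιr).diffeomorph_comp Φ)).IsIsotopic
      (LickorishTwist.knotOfTube ((Ps₀.isSmoothEmbedding_tubePH ι₀ hι₀ hι₀r).diffeomorph_comp Φ₀)) :=
    IsAmbientIsotopic.trans_holds hK (IsAmbientIsotopic.symm_holds hU₀)
  obtain ⟨e⟩ := FramedLink.IsTrace.nonempty_diffeomorph_of_isIsotopic hT hT₀ hiso
  exact ⟨RegularSuperlevel h, inferInstance, inferInstance, inferInstance, inferInstance,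
    inferInstance, inferInstance, inferInstance, bV₀,
    (bP.restrictDiffeomorph bP₀ e).trans (RegularSublevel.splitDiffeomorph h), hV₀, hoV₀, by
      rw [Diffeomorph.coe_trans]; exact hglue.transfer e⟩

/-! ### §3 T from "a `(1,0,1)`-handlebody is a framed-knot trace whose surgery is its boundary"

The hypothesis (P1') of §2 quantifies over EVERY identification `Φ : V ≅ S³` of the level below
the critical point of index `2`, and its conclusion names the `Φ`-dependent knot `Φ ∘ S_L`; for a
`Φ` which is not the boundary restriction of a diffeomorphism `{g ≤ b} ≅ 𝔻 4` a proof of (P1')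
would have to re-identify the `4`-disc along `Φ`, i.e. extend a diffeomorphism of `S³` over `B⁴`
(Cerf).  The form of the bridge that `4`-dimensional handle theory proves directly lets the bridge
CHOOSE the identification: **(P12) for every compact `(1,0,1)`-handlebody `P` and boundary datum
`bP` there is a framed knot `(K, n)` with `∂P = S³ₙ(K)` (`IsIntegralSurgery (𝓡 3) bP.carrier K n`)
AND `(FramedLink.single K n).IsTrace P`** — Kosinski (1993), VII (2.2) over the `4`-disc below the
critical point (Milnor 1963, Thm. 3.1), the level being identified with `S³ = ∂B⁴` by the boundary
restriction of that disc diffeomorphism, together with Kirby (1989), Ch. I Lemma 2.1 / Milnor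
(1965), §3 p. 21 for the boundary (cf. the proved clause (i),
`exists_passageData_isIntegralSurgery_of_hasHandleDecomposition_oneZeroOne`, whose knot is built
with exactly such a `Φ`).  From (P12), T follows given either a closed-up trace of ANY `0`-framed
unknotted knot (`…_of_traceSurgery_of_model`) or Property R (`…_of_traceSurgery_of_propertyR`). -/

/-- **T from (P12) and a closed-up model.**  If every compact `(1,0,1)`-handlebody is, for every
boundary datum, the trace of a framed knot `(K, n)` whose `n`-surgery is that boundary (`hP12`),
and some trace `P₁` of a `0`-framed unknotted knot `K₁` is one piece of a splitting of the round
`S⁴` whose other piece is a compact connected orientable `(1,1)`-handlebody (`hM`), then T holds: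
clause (i) is the first half of (P12); for clause (ii), `K` and `K₁` are both unknotted, hence
isotopic, so `P ≅ P₁` by the uniqueness of the trace
(`FramedLink.IsTrace.nonempty_diffeomorph_of_isIsotopic`) and the splitting transports
(`IsBoundaryGluing.transfer`).  Kirby (1989), Ch. I §2, p. 8; Kosinski (1993), VI (6.6), VII (2.2).
[cite: Kirby1989, Ch. I §2, p. 8] [cite: Kosinski1993, VI (6.6) and VII (2.2)] -/
theorem exists_framedKnot_of_hasHandleDecomposition_oneZeroOne_of_traceSurgery_of_model
    (hP12 : ∀ (P : Type) [TopologicalSpace P] [T2Space P] [SecondCountableTopology P]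
      [ChartedSpace (EuclideanHalfSpace 4) P] [IsManifold (𝓡∂ 4) ∞ P] [CompactSpace P],
      HasHandleDecomposition 3 P (fun k => if k = 0 then 1 else if k = 2 then 1 else 0) →
      ∀ bP : BoundaryData (𝓡∂ 4) P (𝓡 3), ∃ (K : Knot) (n : ℤ),
        IsIntegralSurgery (𝓡 3) bP.carrier K n ∧ (FramedLink.single K n).IsTrace P)
    (hM : ∃ (P₁ : Type) (_ : TopologicalSpace P₁) (_ : ChartedSpace (EuclideanHalfSpace 4) P₁)
      (_ : IsManifold (𝓡∂ 4) ∞ P₁) (K₁ : Knot)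
      (V₁ : Type) (_ : TopologicalSpace V₁) (_ : T2Space V₁) (_ : SecondCountableTopology V₁)
      (_ : ChartedSpace (EuclideanHalfSpace 4) V₁) (_ : IsManifold (𝓡∂ 4) ∞ V₁)
      (_ : CompactSpace V₁) (_ : ConnectedSpace V₁)
      (bP₁ : BoundaryData (𝓡∂ 4) P₁ (𝓡 3)) (bV₁ : BoundaryData (𝓡∂ 4) V₁ (𝓡 3))
      (φ₁ : bP₁.carrier ≃ₘ⟮𝓡 3, 𝓡 3⟯ bV₁.carrier),
      K₁.IsUnknot ∧ (FramedLink.single K₁ 0).IsTrace P₁ ∧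
        HasHandleDecomposition 3 V₁ (handleCount 1 1) ∧ IsOrientable (𝓡∂ 4) V₁ ∧
        IsBoundaryGluing bP₁ bV₁ φ₁ (𝓡 4) (Metric.sphere (0 : EuclideanSpace ℝ (Fin 5)) 1)) :
    exists_framedKnot_of_hasHandleDecomposition_oneZeroOne := by
  intro P _ _ _ _ _ _ hP bP
  obtain ⟨K, n, hsurg, hT⟩ := hP12 P hP bP
  refine ⟨K, n, hsurg, fun hK hn => ?_⟩
  subst hn
  obtain ⟨P₁, _, _, _, K₁, V₁, _, _, _, _, _, _, _, bP₁, bV₁, φ₁, hK₁, hT₁, hV₁, hoV₁, hS⟩ := hM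
  have hiso : K.IsIsotopic K₁ := IsAmbientIsotopic.trans_holds hK (IsAmbientIsotopic.symm_holds hK₁)
  obtain ⟨e⟩ := FramedLink.IsTrace.nonempty_diffeomorph_of_isIsotopic hT hT₁ hiso
  exact ⟨V₁, inferInstance, inferInstance, inferInstance, inferInstance, inferInstance, inferInstance,
    inferInstance, bV₁, (bP.restrictDiffeomorph bP₁ e).trans φ₁, hV₁, hoV₁, by
      rw [Diffeomorph.coe_trans]; exact hS.transfer e⟩

/-- **T from (P12) and Property R** — the recommended residual form: the only handle-theoretic
input left is (P12) (*a compact `(1,0,1)`-handlebody is the trace of a framed knot `(K, n)` with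
`∂P = S³ₙ(K)`*; Kosinski 1993, VII (2.2); Kirby 1989, Ch. I §2 and Lemma 2.1), Property R
(`isUnknot_of_isIntegralSurgery_zero`, Gabai 1987, Cor. 8.3) certifying that the Milnor knot of
the model lower half `P₀` of `S⁴ = P₀ ∪ V₀` (`exists_regularSublevel_sphereFour_oneZeroOne_oneOne`)
is unknotted: `S³_{n₀}(K₀) = ∂P₀ ≅ ∂V₀ ≅ S² × S¹` forces `n₀ = 0`
(`eq_zero_of_isIntegralSurgery_boundary_regularSublevel`) and, after transport to Mathlib's
`S² × S¹`, `K₀` unknotted. [cite: GabaiJDG1987, Cor. 8.3] [cite: Kosinski1993, VII (2.2)]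
[cite: Kirby1989, Ch. I §2, p. 8 and Lemma 2.1] -/
theorem exists_framedKnot_of_hasHandleDecomposition_oneZeroOne_of_traceSurgery_of_propertyR
    (hP12 : ∀ (P : Type) [TopologicalSpace P] [T2Space P] [SecondCountableTopology P]
      [ChartedSpace (EuclideanHalfSpace 4) P] [IsManifold (𝓡∂ 4) ∞ P] [CompactSpace P],
      HasHandleDecomposition 3 P (fun k => if k = 0 then 1 else if k = 2 then 1 else 0) →
      ∀ bP : BoundaryData (𝓡∂ 4) P (𝓡 3), ∃ (K : Knot) (n : ℤ),
        IsIntegralSurgery (𝓡 3) bP.carrier K n ∧ (FramedLink.single K n).IsTrace P)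
    (hPR : isUnknot_of_isIntegralSurgery_zero) :
    exists_framedKnot_of_hasHandleDecomposition_oneZeroOne := by
  obtain ⟨f, c, hf, h, -, -, -, -, h3, h4, hbelow, habove, hP₀, hV₀, -, hcV₀, -, hoV₀, hglue⟩ :=
    exists_regularSublevel_sphereFour_oneZeroOne_oneOne
  haveI : ConnectedSpace (RegularSuperlevel h) := hcV₀
  obtain ⟨K₀, n₀, hsurg₀, hT₀⟩ := hP12 (RegularSublevel h) hP₀ (RegularSublevel.boundaryData h)
  have hn₀0 : n₀ = 0 :=
    eq_zero_of_isIntegralSurgery_boundary_regularSublevel hf h h3 h4 hbelow habove hsurg₀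
  subst hn₀0
  obtain ⟨e₀⟩ := nonempty_diffeomorph_boundary_sphereTwo_prod_of_handleCount_one_one_holds
    (RegularSuperlevel h) hV₀ hoV₀ (RegularSublevel.boundaryData h.const_sub)
  have hU₀ : K₀.IsUnknot :=
    hPR _ (isIntegralSurgery_sphereTwo_prod_sphereOne_of_diffeomorph hsurg₀
      ((RegularSublevel.splitDiffeomorph h).trans e₀))
  exact exists_framedKnot_of_hasHandleDecomposition_oneZeroOne_of_traceSurgery_of_model hP12
    ⟨RegularSublevel h, inferInstance, inferInstance, inferInstance, K₀, RegularSuperlevel h,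
      inferInstance, inferInstance, inferInstance, inferInstance, inferInstance, inferInstance,
      inferInstance, RegularSublevel.boundaryData h, RegularSublevel.boundaryData h.const_sub,
      RegularSublevel.splitDiffeomorph h, hU₀, hT₀, hV₀, hoV₀, hglue⟩

end Literature.Topology.FourManifolds

end
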